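import Summits.ResolutionOfSingularities.ResolutionOfSingularities.Theorems.FrobeniusLadderFInjectiveMacaulayficationCNConeFiModelRelBlowup
import Summits.ResolutionOfSingularities.ResolutionOfSingularities.Theorems.FrobeniusLadderFInjectiveMacaulayficationCertifiedCoverCongr
import HarnessLib

/-!
# [OURS · L1 W4.5a] E7 N3 `TranslatedRelativeCN` — the relative CN exceptional-chart clause AFTER A CHANGE OF COORDINATES
# (e.g. the unit translation `yᵣ ↦ yᵣ + c`): `hon` for the blow-up of `Spec k[y]/(g)` along a TRANSLATED coordinate stratum,
# transported from `CNConeFiModelRelBlowup.chartClause_of_cnData` along one ring isomorphism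

Crux `FrobeniusLadder.FInjectiveMacaulayfication` = stmt-ResolutionOfSingularities-15315 (chain w45a), hole 5e tower format, lead-1's
E7 «two-level format engine» (scoping memo `L/res-L1-w45a-lead-1/E7-SCOPING.md` 04c7249e4caa397e §2 **N3**; res-L1-w45a-plan-1
RULING R12.46 (a) 2026-08-27T10:18:16Z «res-type-034 := E7 N3»). Helper `--supports stmt-ResolutionOfSingularities-15315 --as helper`,
typed by res-type-034. OURS: replaces the role of NOTHING in H. Hironaka's manuscript and is NOT a statement of it; AI-written kernel
glue of the cell `res-hironaka`, weaker than expert review. No definition, no named fact; glue over landed files only.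

THE POINT (memo §2 N3). The level-2 centre of the T₁₁/3 tower is the TRANSLATED line `C̄ = V(y_{J′}, yᵣ + 1)` of a level-1 chart
ring `k[y]/(g)` — NOT a coordinate stratum of the given coordinates, so the relative CN engine (H3-rel: `CNConeFiModelRel` p497132,
named-model chart clause `CNConeFiModelRelBlowup.chartClause_of_cnData`) does not apply literally. It applies to the polynomial
`f̃ := σ⁻¹ g` in which the line IS the stratum `V(y_J)`, `J = J′ ∪ {r}`, where `σ` is the `k`-algebra automorphism `yᵣ ↦ yᵣ + c`
(others fixed): `σ` induces `ε : k[y]/(f̃) ≃+* k[y]/(g)` mapping the monomial centre `I_A` to the TRANSLATED centre and its vertex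
generators `ȳ^{m_c}` to the translated generators; the exceptional-chart clause `hon` moves along `ε` by res-L1-w45a-stub-3's
`CertifiedCoverCongr.certificates_congr` (p507617; `ReesChartCongr.exists_blowupAlgebra_congr` + clause transport inside). Typed:

* §1 `hon_of_cnData_of_ringEquiv` — THE GLUE, generic in the target: all CN-data binders of `chartClause_of_cnData` for a polynomial
  `f̃` and a non-empty `J` VERBATIM, then ANY ring isomorphism `ε : k[y]/(f̃) ≃+* R′` and EQUATION-STYLE binders
  `I′ = ε(I_A·k[y]/(f̃))`, `w c = ε(ȳ^{m_c})` ⊢ the Cohen–Macaulay + Frobenius-closed clause at every maximal `Q` of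
  `blowupAlgebra I′ (w c)` containing `w c/1` — the `hon` binder of N2 `BlowupFiModelOfCoverOverClosed.blowupClause_over_closed`
  (p522238) / N4 `TwoLevelTower.twoLevelTower_good` (p523174) at `R′` (those binders carry an extra, here idle, hypothesis
  `𝔟·chart ≤ Q`). The consumer may take `R′ := Γ(X′, U σ)` directly with `ε :=` «quotient iso of the translation ≫ chart
  presentation⁻¹» (ONE transport), discharging `hI′` by N1 `IdealSheafOfClosedCurve.ideal_vanishingIdeal_eq_of_forall_primeIdealOf_iff`
  (p523270) + §2.
* §2 THE TRANSLATION DICTIONARY (def-free existence forms): `exists_translate_algEquiv` (the `k`-algebra automorphism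
  `σ : yᵣ ↦ yᵣ + C c`, others fixed, with `σ⁻¹ : yᵣ ↦ yᵣ − C c`), `exists_quotientEquiv_of_ringEquiv` (`σ` induces
  `ε : k[y]/(f̃) ≃+* k[y]/(σ f̃)` with `ε (mk x) = mk (σ x)`, Mathlib `Ideal.quotientEquiv`), `map_span_image_mk_eq` (`ε` maps the
  centre `span (mk '' S)` to `span (mk ∘ σ '' S)` — for `S` = the monomials of `A`, the ideal of the translated monomials; for the
  reduced line `A = {y_j : j ∈ J}` this is `(ȳ_j (j ∈ J′), ȳᵣ + c)` = the translated line).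
* §3 `hon_translated` — §1 at `R′ := k[y]/(σ f̃)` with `ε` from §2: the clause for `blowupAlgebra (span (mk_{σf̃} (σ (monomial b 1)) : b ∈ A))
  (mk_{σf̃} (σ (monomial (m c) 1)))`, i.e. for the blow-up of `Spec k[y]/(g)`, `g = σ f̃`, along the TRANSLATED centre.
The CN hypotheses (unimodular vertex charts, (prim) on `J`, Cartier–Newton faces positive on `J`, simultaneous minimiser,
`θ_c f̃ = y^{dv c} g_c` with no `yᵢ ∣ g_c`, `(f̃)` prime, all `x̄ⱼ ≠ 0`) are about the RE-COORDINATISED polynomial `f̃ = σ⁻¹ g` along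
`V(y_J)` — exactly the level-2 certificate data of the memo (tri-1 R1, on paper for T₁₁/3); nothing about them is re-derived here.
References: the cited tree files; The Stacks Project, Tag 0804 (affine blow-up algebras are the charts) — background.
-/

-- single-problem summit: the doubled namespace component is forced
set_option linter.dupNamespace false

noncomputable section

open AlgebraicGeometry CategoryTheory Literature.AlgebraicGeometry.Resolution MvPolynomial

namespace Summit.ResolutionOfSingularities.ResolutionOfSingularities.Theorems.FInjectiveMacaulayfication.TranslatedRelativeCN

open Summit.ResolutionOfSingularities.ResolutionOfSingularities.Theorems.FInjectiveMacaulayfication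

/-! ## §1 The glue: `hon` from the relative CN data, along any ring isomorphism of the base -/

set_option maxHeartbeats 800000 in -- as `CNConeFiModelRelBlowup.chartClause_of_cnData`: slow instance unification on the chart algebras
/-- **E7 N3, generic form: the relative CN exceptional-chart clause transported along a ring isomorphism.** Under the CN data of
`CNConeFiModelRelBlowup.chartClause_of_cnData` for `f̃` along the non-empty coordinate set `J` (binders verbatim), for ANY ring
isomorphism `ε : k[y]/(f̃) ≃+* R′`, any ideal `I′ = ε(I_A·k[y]/(f̃))` and generators `w c = ε(ȳ^{m_c})` (equation-style): the
Cohen–Macaulay + Frobenius-closed clause holds at every maximal ideal `Q` of `blowupAlgebra I′ (w c)` containing `w c/1`.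
(`chartClause_of_cnData` ∘ `CertifiedCoverCongr.certificates_congr`.) [folklore; OURS glue] -/
theorem hon_of_cnData_of_ringEquiv (p : ℕ) [Fact p.Prime] (k : Type) [Field k] [CharP k p] (n : ℕ) (J : Finset (Fin n))
    (hJ : J.Nonempty) (A : Finset (Fin n →₀ ℕ)) (hprim : ∀ j ∈ J, ∃ e : ℕ, 0 < e ∧ Finsupp.single j e ∈ A)
    (t : ℕ) (V : Fin t → Matrix (Fin n) (Fin n) ℕ) (hV : ∀ c, IsUnit ((V c).map (Nat.cast : ℕ → ℤ)).det)
    (m : Fin t → (Fin n →₀ ℕ)) (a : Fin t → Fin n → (Fin n →₀ ℕ)) (haA : ∀ c i, a c i ∈ A)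
    (hgen : ∀ (c : Fin t) (i : Fin n), (Finsupp.equivFunOnFinite.symm ((V c).mulVec ⇑(a c i)) : Fin n →₀ ℕ) =
      Finsupp.equivFunOnFinite.symm ((V c).mulVec ⇑(m c)) + Finsupp.single i 1)
    (hge : ∀ (c : Fin t), ∀ e ∈ A, (Finsupp.equivFunOnFinite.symm ((V c).mulVec ⇑(m c)) : Fin n →₀ ℕ) ≤
      Finsupp.equivFunOnFinite.symm ((V c).mulVec ⇑e))
    (f : MvPolynomial (Fin n) k) (hfprime : (Ideal.span {f}).IsPrime)
    (hXne : ∀ v : Fin n, Ideal.Quotient.mk (Ideal.span {f}) (MvPolynomial.X v) ≠ 0)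
    (hCN : ∀ (c : Fin t) (S : Finset (Fin n)), (∀ j ∈ J, 0 < ∑ i ∈ S, V c i j) →
      (∀ D : ℕ, (MvPolynomial.weightedHomogeneousComponent (fun j : Fin n => ∑ i ∈ S, V c i j) D f ≠ 0 ∧
          ∀ D' < D, MvPolynomial.weightedHomogeneousComponent (fun j : Fin n => ∑ i ∈ S, V c i j) D' f = 0) →
        ∀ (K : Type) [Field K] [Algebra k K] (b : Fin n → K), (∀ i, b i ≠ 0) →
          MvPolynomial.aeval b (MvPolynomial.weightedHomogeneousComponent (fun j : Fin n => ∑ i ∈ S, V c i j) D f) = 0 →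
          (MvPolynomial.map (algebraMap k K) (MvPolynomial.weightedHomogeneousComponent (fun j : Fin n => ∑ i ∈ S, V c i j) D f)) ^ (p - 1) ∉
            Ideal.span (Set.range fun i : Fin n => (MvPolynomial.X i - MvPolynomial.C (b i)) ^ p)))
    (dv : Fin t → (Fin n →₀ ℕ)) (g : Fin t → MvPolynomial (Fin n) k)
    (hg : ∀ c, MvPolynomial.aeval (fun j : Fin n => ∏ i : Fin n, (MvPolynomial.X i : MvPolynomial (Fin n) k) ^ V c i j) f = MvPolynomial.monomial (dv c) 1 * g c)
    (hndiv : ∀ c, ∀ i : Fin n, ¬ (MvPolynomial.X i ∣ g c))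
    (hface : ∀ c, ∃ m ∈ f.support, ∀ i : Fin n, ∑ j : Fin n, V c i j * m j = dv c i)
    {R' : Type} [CommRing R'] (ε : (MvPolynomial (Fin n) k ⧸ Ideal.span {f}) ≃+* R')
    (I' : Ideal R')
    (hI' : I' = Ideal.map ε (Ideal.span ((fun b : Fin n →₀ ℕ => Ideal.Quotient.mk (Ideal.span {f}) (MvPolynomial.monomial b (1 : k))) '' (A : Set (Fin n →₀ ℕ)))))
    (w : Fin t → R') (hw : ∀ c, w c = ε (Ideal.Quotient.mk (Ideal.span {f}) (MvPolynomial.monomial (m c) 1))) :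
    ∀ (c : Fin t) (Q : Ideal (blowupAlgebra I' (w c))) [Q.IsMaximal],
      algebraMap R' (blowupAlgebra I' (w c)) (w c) ∈ Q →
      ∀ d : ℕ, ringKrullDim (Localization.AtPrime Q) = d → ∀ s : Fin d → Localization.AtPrime Q,
        (Ideal.span (Set.range s)).radical.IsMaximal →
          RingTheory.Sequence.IsWeaklyRegular (Localization.AtPrime Q) (List.ofFn s) ∧
          ∀ y : Localization.AtPrime Q, (∃ e : ℕ, y ^ p ^ e ∈ Ideal.span
            ((fun z : Localization.AtPrime Q => z ^ p ^ e) ''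
              (Ideal.span (Set.range s) : Set (Localization.AtPrime Q)))) → y ∈ Ideal.span (Set.range s) := by
  have hw' : w = fun c => ε (Ideal.Quotient.mk (Ideal.span {f}) (MvPolynomial.monomial (m c) 1)) := funext hw
  subst hI' hw'
  intro c Q _ hQ
  exact CertifiedCoverCongr.certificates_congr p ε
    (fun c => Ideal.Quotient.mk (Ideal.span {f}) (MvPolynomial.monomial (m c) 1))
    (fun c' Q' _ hQ' => CNConeFiModelRelBlowup.chartClause_of_cnData p k n J hJ A hprim t V hV m a haA hgen hge f hfprime
      hXne hCN dv g hg hndiv hface c' Q' hQ')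
    c Q hQ

/-! ## §2 The translation dictionary (def-free existence forms) -/

/-- **The unit translation `yᵣ ↦ yᵣ + c` as a `k`-algebra automorphism of `k[y]`** (others fixed), with inverse `yᵣ ↦ yᵣ − c`.
[folklore] -/
theorem exists_translate_algEquiv (k : Type) [Field k] (n : ℕ) (r : Fin n) (c : k) :
    ∃ σ : MvPolynomial (Fin n) k ≃ₐ[k] MvPolynomial (Fin n) k,
      σ (MvPolynomial.X r) = MvPolynomial.X r + MvPolynomial.C c ∧
      (∀ i : Fin n, i ≠ r → σ (MvPolynomial.X i) = MvPolynomial.X i) ∧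
      σ.symm (MvPolynomial.X r) = MvPolynomial.X r - MvPolynomial.C c ∧
      (∀ i : Fin n, i ≠ r → σ.symm (MvPolynomial.X i) = MvPolynomial.X i) := by
  classical
  let φ : MvPolynomial (Fin n) k →ₐ[k] MvPolynomial (Fin n) k :=
    MvPolynomial.aeval fun i => if i = r then MvPolynomial.X r + MvPolynomial.C c else MvPolynomial.X i
  let ψ : MvPolynomial (Fin n) k →ₐ[k] MvPolynomial (Fin n) k :=
    MvPolynomial.aeval fun i => if i = r then MvPolynomial.X r - MvPolynomial.C c else MvPolynomial.X i
  have hφX : ∀ i, φ (MvPolynomial.X i) = if i = r then MvPolynomial.X r + MvPolynomial.C c else MvPolynomial.X i :=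
    fun i => MvPolynomial.aeval_X _ i
  have hψX : ∀ i, ψ (MvPolynomial.X i) = if i = r then MvPolynomial.X r - MvPolynomial.C c else MvPolynomial.X i :=
    fun i => MvPolynomial.aeval_X _ i
  have h₁ : φ.comp ψ = AlgHom.id k _ := by
    refine MvPolynomial.algHom_ext fun i => ?_
    rw [AlgHom.comp_apply, hψX, AlgHom.id_apply]
    split_ifs with h
    · subst h
      rw [map_sub, hφX, if_pos rfl, MvPolynomial.algHom_C, MvPolynomial.algebraMap_eq]
      ring
    · rw [hφX, if_neg h]
  have h₂ : ψ.comp φ = AlgHom.id k _ := by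
    refine MvPolynomial.algHom_ext fun i => ?_
    rw [AlgHom.comp_apply, hφX, AlgHom.id_apply]
    split_ifs with h
    · subst h
      rw [map_add, hψX, if_pos rfl, MvPolynomial.algHom_C, MvPolynomial.algebraMap_eq]
      ring
    · rw [hψX, if_neg h]
  refine ⟨AlgEquiv.ofAlgHom φ ψ h₁ h₂, ?_, fun i hi => ?_, ?_, fun i hi => ?_⟩
  · show φ (MvPolynomial.X r) = _
    rw [hφX, if_pos rfl]
  · show φ (MvPolynomial.X i) = _
    rw [hφX, if_neg hi]
  · show ψ (MvPolynomial.X r) = _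
    rw [hψX, if_pos rfl]
  · show ψ (MvPolynomial.X i) = _
    rw [hψX, if_neg hi]

/-- **A ring automorphism `σ` of `k[y]` induces `k[y]/(f̃) ≃+* k[y]/(σ f̃)` with `mk x ↦ mk (σ x)`** (Mathlib `Ideal.quotientEquiv`,
`Ideal.map_span`). [folklore] -/
theorem exists_quotientEquiv_of_ringEquiv {k : Type} [Field k] {n : ℕ}
    (σ : MvPolynomial (Fin n) k ≃+* MvPolynomial (Fin n) k) (f : MvPolynomial (Fin n) k) :
    ∃ ε : (MvPolynomial (Fin n) k ⧸ Ideal.span {f}) ≃+* (MvPolynomial (Fin n) k ⧸ Ideal.span {σ f}),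
      ∀ x, ε (Ideal.Quotient.mk (Ideal.span {f}) x) = Ideal.Quotient.mk (Ideal.span {σ f}) (σ x) := by
  have h : Ideal.span {σ f} = Ideal.map (σ : MvPolynomial (Fin n) k →+* MvPolynomial (Fin n) k) (Ideal.span {f}) := by
    rw [Ideal.map_span, Set.image_singleton]
    rfl
  exact ⟨Ideal.quotientEquiv _ _ σ h, fun x => Ideal.quotientEquiv_mk _ _ σ h x⟩

/-- **The centre moves to the translated centre**: if `ε (mk x) = mk (σ x)` for all `x`, then for any set `S ⊆ k[y]` (e.g. the
monomials `{y^b : b ∈ A}`), `ε` maps `span (mk '' S)` onto `span ((mk ∘ σ) '' S)`. [folklore] -/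
theorem map_span_image_mk_eq {k : Type} [Field k] {n : ℕ} {f g : MvPolynomial (Fin n) k}
    {σ : MvPolynomial (Fin n) k → MvPolynomial (Fin n) k}
    (ε : (MvPolynomial (Fin n) k ⧸ Ideal.span {f}) ≃+* (MvPolynomial (Fin n) k ⧸ Ideal.span {g}))
    (hε : ∀ x, ε (Ideal.Quotient.mk (Ideal.span {f}) x) = Ideal.Quotient.mk (Ideal.span {g}) (σ x))
    {ι : Type} (S : Set ι) (u : ι → MvPolynomial (Fin n) k) :
    Ideal.map ε (Ideal.span ((fun i => Ideal.Quotient.mk (Ideal.span {f}) (u i)) '' S)) =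
      Ideal.span ((fun i => Ideal.Quotient.mk (Ideal.span {g}) (σ (u i))) '' S) := by
  rw [Ideal.map_span, ← Set.image_comp]
  congr 1
  ext y
  simp only [Set.mem_image, Function.comp_apply]
  constructor
  · rintro ⟨i, hi, rfl⟩
    exact ⟨i, hi, (hε (u i)).symm⟩
  · rintro ⟨i, hi, rfl⟩
    exact ⟨i, hi, hε (u i)⟩

/-! ## §3 The relative CN clause for the TRANSLATED centre of `Spec k[y]/(σ f̃)` -/

set_option maxHeartbeats 1600000 in -- slow instance unification on the chart algebras (cf. `chartClause_of_cnData`, p506193)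
/-- **E7 N3, translated form.** CN data for `f̃` along `V(y_J)` as in §1, a ring automorphism `σ` of `k[y]` (e.g. the translation
`yᵣ ↦ yᵣ + c` of `exists_translate_algEquiv`): the blow-up of `Spec k[y]/(σ f̃)` (`σ f̃ = g`, the level-1 chart equation) along the TRANSLATED centre
`(σ(y^b) : b ∈ A)` satisfies the Cohen–Macaulay + Frobenius-closed clause at every maximal ideal of each translated vertex chart
`(k[y]/(g))[I′/σ(y^{m_c})]` containing `σ(y^{m_c})/1`. (§1 with `ε` from `exists_quotientEquiv_of_ringEquiv`, `hI′` by
`map_span_image_mk_eq`.) [folklore; OURS glue] -/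
theorem hon_translated (p : ℕ) [Fact p.Prime] (k : Type) [Field k] [CharP k p] (n : ℕ) (J : Finset (Fin n))
    (hJ : J.Nonempty) (A : Finset (Fin n →₀ ℕ)) (hprim : ∀ j ∈ J, ∃ e : ℕ, 0 < e ∧ Finsupp.single j e ∈ A)
    (t : ℕ) (V : Fin t → Matrix (Fin n) (Fin n) ℕ) (hV : ∀ c, IsUnit ((V c).map (Nat.cast : ℕ → ℤ)).det)
    (m : Fin t → (Fin n →₀ ℕ)) (a : Fin t → Fin n → (Fin n →₀ ℕ)) (haA : ∀ c i, a c i ∈ A)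
    (hgen : ∀ (c : Fin t) (i : Fin n), (Finsupp.equivFunOnFinite.symm ((V c).mulVec ⇑(a c i)) : Fin n →₀ ℕ) =
      Finsupp.equivFunOnFinite.symm ((V c).mulVec ⇑(m c)) + Finsupp.single i 1)
    (hge : ∀ (c : Fin t), ∀ e ∈ A, (Finsupp.equivFunOnFinite.symm ((V c).mulVec ⇑(m c)) : Fin n →₀ ℕ) ≤
      Finsupp.equivFunOnFinite.symm ((V c).mulVec ⇑e))
    (f : MvPolynomial (Fin n) k) (hfprime : (Ideal.span {f}).IsPrime)
    (hXne : ∀ v : Fin n, Ideal.Quotient.mk (Ideal.span {f}) (MvPolynomial.X v) ≠ 0)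
    (hCN : ∀ (c : Fin t) (S : Finset (Fin n)), (∀ j ∈ J, 0 < ∑ i ∈ S, V c i j) →
      (∀ D : ℕ, (MvPolynomial.weightedHomogeneousComponent (fun j : Fin n => ∑ i ∈ S, V c i j) D f ≠ 0 ∧
          ∀ D' < D, MvPolynomial.weightedHomogeneousComponent (fun j : Fin n => ∑ i ∈ S, V c i j) D' f = 0) →
        ∀ (K : Type) [Field K] [Algebra k K] (b : Fin n → K), (∀ i, b i ≠ 0) →
          MvPolynomial.aeval b (MvPolynomial.weightedHomogeneousComponent (fun j : Fin n => ∑ i ∈ S, V c i j) D f) = 0 →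
          (MvPolynomial.map (algebraMap k K) (MvPolynomial.weightedHomogeneousComponent (fun j : Fin n => ∑ i ∈ S, V c i j) D f)) ^ (p - 1) ∉
            Ideal.span (Set.range fun i : Fin n => (MvPolynomial.X i - MvPolynomial.C (b i)) ^ p)))
    (dv : Fin t → (Fin n →₀ ℕ)) (g : Fin t → MvPolynomial (Fin n) k)
    (hg : ∀ c, MvPolynomial.aeval (fun j : Fin n => ∏ i : Fin n, (MvPolynomial.X i : MvPolynomial (Fin n) k) ^ V c i j) f = MvPolynomial.monomial (dv c) 1 * g c)
    (hndiv : ∀ c, ∀ i : Fin n, ¬ (MvPolynomial.X i ∣ g c))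
    (hface : ∀ c, ∃ m ∈ f.support, ∀ i : Fin n, ∑ j : Fin n, V c i j * m j = dv c i)
    (σ : MvPolynomial (Fin n) k ≃+* MvPolynomial (Fin n) k) :
    ∀ (c : Fin t) (Q : Ideal (blowupAlgebra
        (Ideal.span ((fun b : Fin n →₀ ℕ => Ideal.Quotient.mk (Ideal.span {σ f}) (σ (MvPolynomial.monomial b (1 : k)))) '' (A : Set (Fin n →₀ ℕ))))
        (Ideal.Quotient.mk (Ideal.span {σ f}) (σ (MvPolynomial.monomial (m c) 1))))) [Q.IsMaximal],
      algebraMap (MvPolynomial (Fin n) k ⧸ Ideal.span {σ f}) (blowupAlgebra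
        (Ideal.span ((fun b : Fin n →₀ ℕ => Ideal.Quotient.mk (Ideal.span {σ f}) (σ (MvPolynomial.monomial b (1 : k)))) '' (A : Set (Fin n →₀ ℕ))))
        (Ideal.Quotient.mk (Ideal.span {σ f}) (σ (MvPolynomial.monomial (m c) 1))))
        (Ideal.Quotient.mk (Ideal.span {σ f}) (σ (MvPolynomial.monomial (m c) 1))) ∈ Q →
      ∀ d : ℕ, ringKrullDim (Localization.AtPrime Q) = d → ∀ s : Fin d → Localization.AtPrime Q,
        (Ideal.span (Set.range s)).radical.IsMaximal →
          RingTheory.Sequence.IsWeaklyRegular (Localization.AtPrime Q) (List.ofFn s) ∧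
          ∀ y : Localization.AtPrime Q, (∃ e : ℕ, y ^ p ^ e ∈ Ideal.span
            ((fun z : Localization.AtPrime Q => z ^ p ^ e) ''
              (Ideal.span (Set.range s) : Set (Localization.AtPrime Q)))) → y ∈ Ideal.span (Set.range s) := by
  obtain ⟨ε, hε⟩ := exists_quotientEquiv_of_ringEquiv σ f
  have hI' : Ideal.span ((fun b : Fin n →₀ ℕ => Ideal.Quotient.mk (Ideal.span {σ f}) (σ (MvPolynomial.monomial b (1 : k)))) ''
        (A : Set (Fin n →₀ ℕ))) =
      Ideal.map ε (Ideal.span ((fun b : Fin n →₀ ℕ => Ideal.Quotient.mk (Ideal.span {f}) (MvPolynomial.monomial b (1 : k))) ''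
        (A : Set (Fin n →₀ ℕ)))) :=
    (map_span_image_mk_eq ε hε (A : Set (Fin n →₀ ℕ)) (fun b : Fin n →₀ ℕ => MvPolynomial.monomial b (1 : k))).symm
  have hw : ∀ c : Fin t, Ideal.Quotient.mk (Ideal.span {σ f}) (σ (MvPolynomial.monomial (m c) 1)) =
      ε (Ideal.Quotient.mk (Ideal.span {f}) (MvPolynomial.monomial (m c) 1)) := fun c => (hε _).symm
  have h := hon_of_cnData_of_ringEquiv p k n J hJ A hprim t V hV m a haA hgen hge f hfprime hXne hCN dv g hg hndiv hface ε
    (Ideal.span ((fun b : Fin n →₀ ℕ => Ideal.Quotient.mk (Ideal.span {σ f}) (σ (MvPolynomial.monomial b (1 : k)))) ''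
      (A : Set (Fin n →₀ ℕ))))
    hI' (fun c => Ideal.Quotient.mk (Ideal.span {σ f}) (σ (MvPolynomial.monomial (m c) 1))) hw
  beta_reduce at h
  exact h

end Summit.ResolutionOfSingularities.ResolutionOfSingularities.Theorems.FInjectiveMacaulayfication.TranslatedRelativeCN

end
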